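import Literature.Analysis.FluidPDE.NSRegFourierBilinear
import Literature.Analysis.FluidPDE.NSFourierMild
import HarnessLib

/-!
# The Duhamel term of the Leray-regularised Navier–Stokes system on the Fourier side:
# weighted `L²` and pointwise estimates

Second file of the Fourier-side construction of the global regular solution of the
Leray-regularised Navier–Stokes system (discharge of
`Literature.Analysis.FluidPDE.leray_regularised_wellposed`; first file `NSRegFourierBilinear`).
For time-dependent coefficient fields `V, W : ℝ → E → (ι → ℂ)` (`E = EuclideanSpace ℝ ι`), a heat
rate `c > 0` and a mollifier multiplier `m`, the (clamped) **regularised Duhamel term** is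

  `D(V, W)(t, ξ) = ∫₀^τ e^{-c‖ξ‖²(τ-s)} N(m • V(s), W(s))(ξ) ds`,  `τ = clamp T t`

(`FourierNS.nonlin`, `FourierNS.vmul`; Leray 1934, §26 with (3.11); Ożański–Pooley 2018, (6.77) in
mild form). This file proves, under joint measurability of `V`, `W` and the uniform bounds
`‖V(s)‖_{L²} ≤ A`, `‖wfun J W(s)‖_{L²} ≤ B`:

* `IsMollifierSymbol m` — the standing hypotheses on the multiplier (measurable, `|m| ≤ 1`, even,
  `(1+‖ξ‖)^K |m| ≤ M_K` for every `K`), and their consequence `‖wfun K m‖_{L²} < ∞`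
  (`IsMollifierSymbol.eLpNorm_wfun_lt_top`);
* `lintegral_heat_sq_le` — the **heat gain** `‖ξ‖² ∫₀^τ e^{-2c‖ξ‖²(τ-s)} ds ≤ 1/(2c)` in `ℝ≥0∞` form;
* `measurable_fconv_param`, `measurable_nonlin_param`, `measurable_convSum_param` — joint
  measurability in `(s, ξ)`;
* `duhamelR c m T V W` — the clamped regularised Duhamel term; `SliceBound J A B V W` — the
  hypotheses; interval integrability of the integrand, measurability of the slices
  (`measurable_duhamelR_slice`), time continuity at each frequency (`continuous_duhamelR_time`),
  joint measurability (`measurable_uncurry_duhamelR`), bilinearity (`duhamelR_sub_left/right`);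
* `SliceBound.weight_mul_enorm_duhamelR_le_Z` — Cauchy–Schwarz in time with the heat gain:
  `(1+‖ξ‖)^J ‖D(t,ξ)‖ ≤ 4π (2c)^{-1/2} (∫₀^τ G(s,ξ)² ds)^{1/2}`, `G = (1+‖ξ‖)^J S` the weighted
  convolution sum;
* `SliceBound.weight_mul_enorm_duhamelR_le` — the **pointwise** bound
  `(1+‖ξ‖)^J ‖D(t,ξ)‖ ≤ 4π (2c)^{-1/2} T^{1/2} card² M_J A B` (decay of order `J` at every frequency);
* `SliceBound.eLpNorm_wfun_duhamelR_le` — the **weighted `L²`** bound (Tonelli)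
  `‖wfun J D(t)‖_{L²} ≤ 4π (2c)^{-1/2} T^{1/2} card² ‖wfun J m‖_{L²} A B`.

The advecting field enters through `A = sup ‖V‖_{L²}` only; this is the estimate that makes the
local time of the Picard scheme (`NSRegFourierPicard`) depend on the conserved `L²` norm alone.

## Mathlib / tree search

`ENNReal.lintegral_mul_le_Lp_mul_Lq`, `lintegral_lintegral_swap`, `enorm_integral_le_lintegral_enorm`,
`intervalIntegral.integral_of_le`, `Measure.integrableOn_of_bounded`,
`intervalIntegral.continuous_primitive`, `StronglyMeasurable.integral_prod_right'`,
`stronglyMeasurable_uncurry_of_continuous_of_stronglyMeasurable`; from the tree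
`FourierNS.heat`, `FourierNS.clamp`, `FourierNS.heat_add` (`NSFourierMild`),
`FourierNS.integral_exp_neg_mul_sub_le` (the heat-time integral), and `NSRegFourierBilinear`.

## References

* J. Leray, Acta Math. 63 (1934), §19 (3.11), Ch. V §26. [Leray1934]
* W. S. Ożański, B. C. Pooley, LMS Lecture Note Ser. 452 (2018), §6.4, (6.77)–(6.81). [OzanskiPooley2018]
* P. G. Lemarié-Rieusset, *The Navier–Stokes problem in the 21st century* (2016), §8.5.
-/

noncomputable section

open MeasureTheory Real Set Filter Topology Function Complex intervalIntegral
open scoped ENNReal NNReal ComplexConjugate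

namespace Literature.Analysis.FluidPDE.FourierNS

variable {ι : Type*} [Fintype ι] [DecidableEq ι]

/-! ### The mollifier multiplier -/

omit [DecidableEq ι] in
/-- **Standing hypotheses on the Fourier multiplier `m` of the mollification** `J u = χ ⋆ u`,
`m = 𝓕⁻¹ χ` (`χ` a normalised, nonnegative, radial bump): `m` is measurable, real with `|m| ≤ 1`
(`|𝓕⁻¹χ| ≤ ∫ χ = 1`), even (`χ` is even), and decays faster than every polynomial (`χ` is a
Schwartz function). Only these properties of `m` are used by the regularised scheme. [folklore] -/
structure IsMollifierSymbol (m : (EuclideanSpace ℝ ι) → ℝ) : Prop where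
  /-- measurability -/
  measurable : Measurable m
  /-- `|m| ≤ 1` -/
  abs_le_one : ∀ ξ, |m ξ| ≤ 1
  /-- evenness `m(-ξ) = m(ξ)` -/
  even : ∀ ξ, m (-ξ) = m ξ
  /-- decay of every polynomial order -/
  decay : ∀ K : ℕ, ∃ M : ℝ, ∀ ξ, (1 + ‖ξ‖) ^ K * |m ξ| ≤ M

namespace IsMollifierSymbol

variable {m : (EuclideanSpace ℝ ι) → ℝ}

omit [DecidableEq ι] in
/-- The decay constants can be taken nonnegative. [folklore] -/
theorem decay' (hm : IsMollifierSymbol m) (K : ℕ) : ∃ M : ℝ, 0 ≤ M ∧ ∀ ξ, (1 + ‖ξ‖) ^ K * |m ξ| ≤ M := by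
  obtain ⟨M, hM⟩ := hm.decay K
  exact ⟨M, le_trans (by positivity) (hM 0), hM⟩

omit [DecidableEq ι] in
/-- The complexified multiplier is measurable. [folklore] -/
theorem measurable_ofReal (hm : IsMollifierSymbol m) : Measurable fun ξ => (m ξ : ℂ) :=
  Complex.measurable_ofReal.comp hm.measurable

omit [DecidableEq ι] in
/-- The inverse weight `(1+‖ξ‖)^{-K₀}` is square integrable for `K₀ > card ι` (it is integrable
and bounded by `1`). [folklore] -/
theorem memLp_two_inv_weight {K₀ : ℕ} (hK₀ : Fintype.card ι < K₀) :
    MemLp (fun ξ : EuclideanSpace ℝ ι => ((1 + ‖ξ‖) ^ K₀)⁻¹) 2 volume := by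
  have hint : Integrable (fun ξ : EuclideanSpace ℝ ι => ((1 + ‖ξ‖) ^ K₀)⁻¹) volume :=
    integrable_inv_one_add_norm_pow (finrank_lt_of_card_lt hK₀)
  refine ⟨hint.aestronglyMeasurable, ?_⟩
  have h2 : eLpNorm (fun ξ : EuclideanSpace ℝ ι => ((1 + ‖ξ‖) ^ K₀)⁻¹) 2 volume ^ 2 ≤
      ∫⁻ ξ : EuclideanSpace ℝ ι, ‖((1 + ‖ξ‖) ^ K₀)⁻¹‖ₑ := by
    rw [← lintegral_enorm_sq_eq_eLpNorm_sq]
    refine lintegral_mono fun ξ => ?_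
    have h0 : 0 ≤ ((1 + ‖ξ‖) ^ K₀)⁻¹ := by positivity
    rw [Real.enorm_eq_ofReal h0, sq]
    calc ENNReal.ofReal ((1 + ‖ξ‖) ^ K₀)⁻¹ * ENNReal.ofReal ((1 + ‖ξ‖) ^ K₀)⁻¹
        ≤ 1 * ENNReal.ofReal ((1 + ‖ξ‖) ^ K₀)⁻¹ :=
          mul_le_mul_left (ENNReal.ofReal_le_one.2 (inv_one_add_norm_pow_le_one ξ K₀)) _
      _ = _ := one_mul _
  have hfin : ∫⁻ ξ : EuclideanSpace ℝ ι, ‖((1 + ‖ξ‖) ^ K₀)⁻¹‖ₑ < ∞ := hint.hasFiniteIntegral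
  have : eLpNorm (fun ξ : EuclideanSpace ℝ ι => ((1 + ‖ξ‖) ^ K₀)⁻¹) 2 volume ^ 2 < ∞ :=
    lt_of_le_of_lt h2 hfin
  by_contra htop
  rw [not_lt, top_le_iff] at htop
  rw [htop] at this
  simp at this

omit [DecidableEq ι] in
/-- **Every weighted `L²` norm of the multiplier is finite**: `‖wfun K m‖_{L²} < ∞`
(`(1+‖ξ‖)^K |m| ≤ M_{K+K₀} (1+‖ξ‖)^{-K₀}` with `K₀ = card ι + 1`). [folklore] -/
theorem eLpNorm_wfun_lt_top (hm : IsMollifierSymbol m) (K : ℕ) :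
    eLpNorm (wfun K fun ξ => (m ξ : ℂ)) 2 volume < ∞ := by
  set K₀ : ℕ := Fintype.card ι + 1
  obtain ⟨M, hM0, hM⟩ := hm.decay' (K + K₀)
  have hw := memLp_two_inv_weight (ι := ι) (K₀ := K₀) (Nat.lt_succ_self _)
  have hle : ∀ ξ : EuclideanSpace ℝ ι, ‖wfun K (fun ξ => (m ξ : ℂ)) ξ‖ ≤ M * ((1 + ‖ξ‖) ^ K₀)⁻¹ := by
    intro ξ
    rw [norm_wfun, Complex.norm_real, Real.norm_eq_abs]
    have hpos : 0 < (1 + ‖ξ‖) ^ K₀ := by positivity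
    rw [le_mul_inv_iff₀ hpos]
    calc (1 + ‖ξ‖) ^ K * |m ξ| * (1 + ‖ξ‖) ^ K₀ = (1 + ‖ξ‖) ^ (K + K₀) * |m ξ| := by rw [pow_add]; ring
      _ ≤ M := hM ξ
  have hmem : MemLp (wfun K fun ξ => (m ξ : ℂ)) 2 (volume : Measure (EuclideanSpace ℝ ι)) := by
    refine (hw.const_mul M).mono' (aestronglyMeasurable_wfun K hm.measurable_ofReal.aestronglyMeasurable)
      (Eventually.of_forall fun ξ => ?_)
    simpa using hle ξ
  exact hmem.eLpNorm_lt_top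

end IsMollifierSymbol

/-! ### The heat gain in `ℝ≥0∞` form -/

omit [Fintype ι] [DecidableEq ι] in
/-- **Heat gain**, `ℝ≥0∞` form: `∫⁻_{(0,τ]} (‖ξ‖ e^{-c‖ξ‖²(τ-s)})² ds ≤ 1/(2c)` for `c > 0`
(`‖ξ‖² ∫₀^τ e^{-2c‖ξ‖²(τ-s)} ds = (1 - e^{-2c‖ξ‖²τ})/(2c)`; Lemarié-Rieusset 2016, §8.5). [folklore] -/
theorem lintegral_heat_sq_le {E' : Type*} [NormedAddCommGroup E'] {c τ : ℝ} (hc : 0 < c) (hτ : 0 ≤ τ)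
    (ξ : E') :
    ∫⁻ s in Ioc 0 τ, ENNReal.ofReal (‖ξ‖ * heat c ξ (τ - s)) ^ 2 ≤ ENNReal.ofReal (1 / (2 * c)) := by
  rcases eq_or_ne ‖ξ‖ 0 with h0 | h0
  · simp [h0]
  have hξ : 0 < ‖ξ‖ := lt_of_le_of_ne (norm_nonneg _) (Ne.symm h0)
  set γ : ℝ := 2 * c * ‖ξ‖ ^ 2 with hγ
  have hγ0 : 0 < γ := by positivity
  -- the integrand squared is `‖ξ‖² e^{-γ (τ - s)}`
  have hsq : ∀ s, ENNReal.ofReal (‖ξ‖ * heat c ξ (τ - s)) ^ 2 =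
      ENNReal.ofReal (‖ξ‖ ^ 2 * Real.exp (-γ * (τ - s))) := by
    intro s
    rw [← ENNReal.ofReal_pow (by have := heat_nonneg c ξ (τ - s); positivity)]
    congr 1
    rw [mul_pow, heat, ← Real.exp_nat_mul]
    congr 1
    rw [hγ]
    push_cast
    ring
  simp_rw [hsq]
  have hcont : Continuous fun s => ‖ξ‖ ^ 2 * Real.exp (-γ * (τ - s)) := by fun_prop
  have hint : IntegrableOn (fun s => ‖ξ‖ ^ 2 * Real.exp (-γ * (τ - s))) (Ioc 0 τ) volume :=
    (hcont.integrableOn_Icc (a := 0) (b := τ)).mono_set Ioc_subset_Icc_self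
  rw [← ofReal_integral_eq_lintegral_ofReal hint (ae_of_all _ fun s => by positivity)]
  refine ENNReal.ofReal_le_ofReal ?_
  rw [← intervalIntegral.integral_of_le hτ, intervalIntegral.integral_const_mul]
  calc ‖ξ‖ ^ 2 * ∫ s in (0 : ℝ)..τ, Real.exp (-γ * (τ - s)) ≤ ‖ξ‖ ^ 2 * (1 / γ) :=
        mul_le_mul_of_nonneg_left (integral_exp_neg_mul_sub_le hγ0) (by positivity)
    _ = 1 / (2 * c) := by rw [hγ]; field_simp

/-! ### Joint measurability of parametrised convolutions and of the nonlinearity -/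

section Measurability

variable {m : (EuclideanSpace ℝ ι) → ℝ} {V W : ℝ → (EuclideanSpace ℝ ι) → ι → ℂ}

omit [DecidableEq ι] in
/-- **Fubini measurability of a parametrised convolution**: for jointly measurable
`F, G : ℝ × E → ℂ` the map `(s, ξ) ↦ (F(s) ⋆ G(s))(ξ)` is jointly measurable (no integrability
needed: Mathlib's `StronglyMeasurable.integral_prod_right'`). [folklore] -/
theorem measurable_fconv_param {F G : ℝ → (EuclideanSpace ℝ ι) → ℂ} (hF : Measurable (uncurry F))
    (hG : Measurable (uncurry G)) : Measurable (uncurry fun s ξ => fconv (F s) (G s) ξ) := by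
  have h1 : Measurable fun p : (ℝ × EuclideanSpace ℝ ι) × EuclideanSpace ℝ ι => F p.1.1 p.2 :=
    hF.comp (measurable_fst.fst.prodMk measurable_snd)
  have h2 : Measurable fun p : (ℝ × EuclideanSpace ℝ ι) × EuclideanSpace ℝ ι => G p.1.1 (p.1.2 - p.2) :=
    hG.comp (measurable_fst.fst.prodMk (measurable_fst.snd.sub measurable_snd))
  have hI : StronglyMeasurable (uncurry fun (p : ℝ × EuclideanSpace ℝ ι) (η : EuclideanSpace ℝ ι) =>
      F p.1 η * G p.1 (p.2 - η)) := (h1.mul h2).stronglyMeasurable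
  have h := hI.integral_prod_right' (ν := (volume : Measure (EuclideanSpace ℝ ι)))
  have heq : (fun p : ℝ × EuclideanSpace ℝ ι => ∫ η, uncurry (fun (p : ℝ × EuclideanSpace ℝ ι)
      (η : EuclideanSpace ℝ ι) => F p.1 η * G p.1 (p.2 - η)) (p, η)) =
      uncurry fun s ξ => fconv (F s) (G s) ξ := by
    funext p
    rcases p with ⟨s, ξ⟩
    simp only [uncurry_apply_pair, fconv_apply]
  rw [heq] at h
  exact h.measurable

omit [Fintype ι] [DecidableEq ι] in
/-- Slices of a jointly measurable field are measurable. [folklore] -/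
theorem measurable_slice {X : Type*} [MeasurableSpace X] {F : ℝ → (EuclideanSpace ℝ ι) → X}
    (hF : Measurable (uncurry F)) (s : ℝ) : Measurable (F s) :=
  hF.comp (measurable_const.prodMk measurable_id)

omit [Fintype ι] [DecidableEq ι] in
/-- Joint measurability of `(s, ξ) ↦ (m • V(s))(ξ)`. [folklore] -/
theorem measurable_uncurry_vmul (hm : Measurable m) (hV : Measurable (uncurry V)) :
    Measurable (uncurry fun s ξ => vmul m (V s) ξ) := by
  refine measurable_pi_iff.2 fun j => ?_
  exact ((Complex.measurable_ofReal.comp hm).comp measurable_snd).mul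
    ((measurable_pi_iff.1 hV j))

/-- **Joint measurability of the regularised nonlinearity** `(s, ξ) ↦ N(m • V(s), W(s))(ξ)`. [folklore] -/
theorem measurable_nonlin_param (hm : Measurable m) (hV : Measurable (uncurry V)) (hW : Measurable (uncurry W)) :
    Measurable (uncurry fun s ξ => nonlin (vmul m (V s)) (W s) ξ) := by
  refine measurable_pi_iff.2 fun l => ?_
  have hmV := measurable_uncurry_vmul hm hV
  have hterm : ∀ j k, Measurable fun p : ℝ × EuclideanSpace ℝ ι =>
      (lerayDerivSymbol j k l p.2 : ℂ) * fconv (fun η => vmul m (V p.1) η j) (W p.1 · k) p.2 := by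
    intro j k
    refine ((Complex.measurable_ofReal.comp (continuous_lerayDerivSymbol j k l).measurable).comp
      measurable_snd).mul ?_
    exact measurable_fconv_param (F := fun s η => vmul m (V s) η j) (G := fun s η => W s η k)
      (measurable_pi_iff.1 hmV j) (measurable_pi_iff.1 hW k)
  have heq : (fun p : ℝ × EuclideanSpace ℝ ι => uncurry (fun s ξ => nonlin (vmul m (V s)) (W s) ξ) p l) =
      fun p => -(2 * π * Complex.I) * ∑ j, ∑ k,
        (lerayDerivSymbol j k l p.2 : ℂ) * fconv (fun η => vmul m (V p.1) η j) (W p.1 · k) p.2 := by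
    funext p; rfl
  rw [heq]
  exact (Finset.measurable_sum _ fun j _ => Finset.measurable_sum _ fun k _ => hterm j k).const_mul _

omit [DecidableEq ι] in
/-- **Joint measurability of the convolution sum** `(s, ξ) ↦ S(m • V(s), W(s))(ξ)`. [folklore] -/
theorem measurable_convSum_param (hm : Measurable m) (hV : Measurable (uncurry V))
    (hW : Measurable (uncurry W)) :
    Measurable (uncurry fun s ξ => convSum (vmul m (V s)) (W s) ξ) := by
  have hmV := measurable_uncurry_vmul hm hV
  have heq : uncurry (fun s ξ => convSum (vmul m (V s)) (W s) ξ) = fun p : ℝ × EuclideanSpace ℝ ι =>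
      ∑ j, ∑ k, ‖fconv (fun η => vmul m (V p.1) η j) (W p.1 · k) p.2‖ := by
    funext p; rfl
  rw [heq]
  refine Finset.measurable_sum _ fun j _ => Finset.measurable_sum _ fun k _ => ?_
  exact (measurable_fconv_param (F := fun s η => vmul m (V s) η j) (G := fun s η => W s η k)
    (measurable_pi_iff.1 hmV j) (measurable_pi_iff.1 hW k)).norm

end Measurability

/-! ### The regularised Duhamel term -/

section Duhamel

variable {c T : ℝ} {m : (EuclideanSpace ℝ ι) → ℝ} {V W : ℝ → (EuclideanSpace ℝ ι) → ι → ℂ}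
  {J : ℕ} {A B : ℝ≥0∞}

/-- The **regularised Duhamel term** (clamped to `[0, T]`):
`D(V, W)(t, ξ) = ∫₀^τ e^{-c‖ξ‖²(τ-s)} N(m • V(s), W(s))(ξ) ds`, `τ = clamp T t` — the nonlinear part
of the mild form of the Leray-regularised system with advecting field `𝓕(m • V)` and advected
field `𝓕 W` (Leray 1934, §26 with §19 (3.11); Ożański–Pooley 2018, (6.77)). Bilinear in `(V, W)`;
the solution is the fixed point of `v ↦ e^{-c‖ξ‖²τ} a − D(v, v)`. [folklore] -/
def duhamelR (c : ℝ) (m : (EuclideanSpace ℝ ι) → ℝ) (T : ℝ) (V W : ℝ → (EuclideanSpace ℝ ι) → ι → ℂ)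
    (t : ℝ) (ξ : EuclideanSpace ℝ ι) : ι → ℂ :=
  ∫ s in (0 : ℝ)..clamp T t, heat c ξ (clamp T t - s) • nonlin (vmul m (V s)) (W s) ξ

/-- `D(t) = D(clamp T t)`. [folklore] -/
theorem duhamelR_clamp (hT : 0 ≤ T) (t : ℝ) (ξ : EuclideanSpace ℝ ι) :
    duhamelR c m T V W (clamp T t) ξ = duhamelR c m T V W t ξ := by
  simp only [duhamelR, clamp_clamp hT]

/-- `D(0) = 0`. [folklore] -/
theorem duhamelR_zero (hT : 0 ≤ T) (ξ : EuclideanSpace ℝ ι) : duhamelR c m T V W 0 ξ = 0 := by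
  simp [duhamelR, clamp_zero hT]

omit [DecidableEq ι] in
/-- **Uniform slice bounds** for a pair of time-dependent coefficient fields: joint measurability,
`‖V(s)‖_{L²} ≤ A < ∞` (advecting field, unweighted) and `‖wfun J W(s)‖_{L²} ≤ B < ∞` (advected
field, weight `J`) for all `s`. The hypotheses under which the Duhamel term is estimated. [folklore] -/
structure SliceBound (J : ℕ) (A B : ℝ≥0∞) (V W : ℝ → (EuclideanSpace ℝ ι) → ι → ℂ) : Prop where
  /-- joint measurability of the advecting field -/
  measV : Measurable (uncurry V)
  /-- joint measurability of the advected field -/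
  measW : Measurable (uncurry W)
  /-- the `L²` bound of the advecting field -/
  boundV : ∀ s, eLpNorm (V s) 2 volume ≤ A
  /-- the weighted `L²` bound of the advected field -/
  boundW : ∀ s, eLpNorm (wfun J (W s)) 2 volume ≤ B
  /-- finiteness -/
  A_ne_top : A ≠ ∞
  /-- finiteness -/
  B_ne_top : B ≠ ∞

namespace SliceBound

omit [DecidableEq ι] in
/-- The unweighted bound of the advected field. [folklore] -/
theorem boundW₀ (h : SliceBound J A B V W) (s : ℝ) : eLpNorm (W s) 2 volume ≤ B :=
  (eLpNorm_le_eLpNorm_wfun J (W s) 2).trans (h.boundW s)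

omit [DecidableEq ι] in
/-- Lowering the weight keeps the bounds. [folklore] -/
theorem of_le (h : SliceBound J A B V W) {J' : ℕ} (hJ : J' ≤ J) : SliceBound J' A B V W where
  measV := h.measV
  measW := h.measW
  boundV := h.boundV
  boundW s := (eLpNorm_wfun_mono hJ (W s) 2).trans (h.boundW s)
  A_ne_top := h.A_ne_top
  B_ne_top := h.B_ne_top

omit [DecidableEq ι] in
/-- **Pointwise weighted bound of the convolution sum of the slices**: with `(1+‖ξ‖)^J |m| ≤ M`,
`(1+‖ξ‖)^J S(m•V(s), W(s))(ξ) ≤ card² M A B` (finite). [folklore] -/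
theorem weight_mul_convSum_le (h : SliceBound J A B V W) (hm : Measurable m) {M : ℝ}
    (hM : ∀ ξ, (1 + ‖ξ‖) ^ J * |m ξ| ≤ M) (s : ℝ) (ξ : EuclideanSpace ℝ ι) :
    ENNReal.ofReal ((1 + ‖ξ‖) ^ J * convSum (vmul m (V s)) (W s) ξ) ≤
      (Fintype.card ι : ℝ≥0∞) ^ 2 * (ENNReal.ofReal M * A * B) := by
  refine (FourierNS.weight_mul_convSum_le hm (measurable_slice h.measV s) (measurable_slice h.measW s)
    hM ξ).trans ?_
  gcongr
  · exact h.boundV s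
  · exact h.boundW s

omit [DecidableEq ι] in
/-- Real form of the unweighted pointwise bound: `S(m•V(s), W(s))(ξ) ≤ (card² A B).toReal`
(`|m| ≤ 1`). [folklore] -/
theorem convSum_le_toReal (h : SliceBound J A B V W) (hm : Measurable m) (hm1 : ∀ ξ, |m ξ| ≤ 1)
    (s : ℝ) (ξ : EuclideanSpace ℝ ι) :
    convSum (vmul m (V s)) (W s) ξ ≤ ((Fintype.card ι : ℝ≥0∞) ^ 2 * (A * B)).toReal := by
  have h0 := (h.of_le (Nat.zero_le J)).weight_mul_convSum_le hm (M := 1) (fun ξ => by simpa using hm1 ξ) s ξ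
  simp only [pow_zero, one_mul, ENNReal.ofReal_one] at h0
  refine (ENNReal.ofReal_le_iff_le_toReal ?_).1 h0
  exact ENNReal.mul_ne_top (ENNReal.pow_ne_top (ENNReal.natCast_ne_top _))
    (ENNReal.mul_ne_top h.A_ne_top h.B_ne_top)

/-- Measurability in `s` of the nonlinearity at a fixed frequency. [folklore] -/
theorem measurable_nonlin_time (h : SliceBound J A B V W) (hm : Measurable m) (ξ : EuclideanSpace ℝ ι) :
    Measurable fun s : ℝ => nonlin (vmul m (V s)) (W s) ξ := by
  have hc : Measurable fun s : ℝ => (s, ξ) := measurable_id.prodMk measurable_const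
  have h0 : Measurable (uncurry fun s ξ => nonlin (vmul m (V s)) (W s) ξ) :=
    measurable_nonlin_param hm h.measV h.measW
  have h1 : Measurable ((uncurry fun s ξ => nonlin (vmul m (V s)) (W s) ξ) ∘ fun s : ℝ => (s, ξ)) :=
    h0.comp hc
  simpa only [Function.comp_def, uncurry_apply_pair] using h1

/-- Measurability in `s` of the Duhamel integrand at fixed `(τ, ξ)`. [folklore] -/
theorem measurable_integrand (h : SliceBound J A B V W) (hm : Measurable m) (c τ : ℝ)
    (ξ : EuclideanSpace ℝ ι) :
    Measurable fun s => heat c ξ (τ - s) • nonlin (vmul m (V s)) (W s) ξ := by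
  have h1 : Measurable fun s : ℝ => heat c ξ (τ - s) := by unfold heat; fun_prop
  exact h1.smul (h.measurable_nonlin_time hm ξ)

/-- **Boundedness of the Duhamel integrand** on `s ≤ τ` (`c ≥ 0`):
`‖e^{-c‖ξ‖²(τ-s)} N(m•V(s), W(s))(ξ)‖ ≤ 4π ‖ξ‖ (card² A B).toReal`. [folklore] -/
theorem norm_integrand_le (h : SliceBound J A B V W) (hm : Measurable m) (hm1 : ∀ ξ, |m ξ| ≤ 1)
    (hc : 0 ≤ c) {τ s : ℝ} (hs : s ≤ τ) (ξ : EuclideanSpace ℝ ι) :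
    ‖heat c ξ (τ - s) • nonlin (vmul m (V s)) (W s) ξ‖ ≤
      4 * π * ‖ξ‖ * ((Fintype.card ι : ℝ≥0∞) ^ 2 * (A * B)).toReal := by
  rw [norm_heat_smul]
  calc heat c ξ (τ - s) * ‖nonlin (vmul m (V s)) (W s) ξ‖ ≤ 1 * ‖nonlin (vmul m (V s)) (W s) ξ‖ :=
        mul_le_mul_of_nonneg_right (heat_le_one hc (sub_nonneg.2 hs) ξ) (norm_nonneg _)
    _ ≤ 4 * π * ‖ξ‖ * convSum (vmul m (V s)) (W s) ξ := by
        rw [one_mul]; exact norm_nonlin_le_convSum' _ _ ξ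
    _ ≤ 4 * π * ‖ξ‖ * ((Fintype.card ι : ℝ≥0∞) ^ 2 * (A * B)).toReal :=
        mul_le_mul_of_nonneg_left (h.convSum_le_toReal hm hm1 s ξ) (by positivity)

/-- **Interval integrability of the Duhamel integrand** on `[0, τ]`, `τ ≥ 0` (measurable and
bounded on a finite interval). [folklore] -/
theorem intervalIntegrable_integrand (h : SliceBound J A B V W) (hm : Measurable m)
    (hm1 : ∀ ξ, |m ξ| ≤ 1) (hc : 0 ≤ c) {τ : ℝ} (hτ : 0 ≤ τ) (ξ : EuclideanSpace ℝ ι) :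
    IntervalIntegrable (fun s => heat c ξ (τ - s) • nonlin (vmul m (V s)) (W s) ξ) volume 0 τ := by
  rw [intervalIntegrable_iff_integrableOn_Ioc_of_le hτ]
  refine Measure.integrableOn_of_bounded (M := 4 * π * ‖ξ‖ * ((Fintype.card ι : ℝ≥0∞) ^ 2 * (A * B)).toReal)
    measure_Ioc_lt_top.ne (h.measurable_integrand hm c τ ξ).aestronglyMeasurable ?_
  exact (ae_restrict_iff' measurableSet_Ioc).2 (Eventually.of_forall fun s hs =>
    h.norm_integrand_le hm hm1 hc hs.2 ξ)

end SliceBound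

end Duhamel

/-! ### The estimates of the Duhamel term -/

section Estimates

variable {c T : ℝ} {m : (EuclideanSpace ℝ ι) → ℝ} {V W : ℝ → (EuclideanSpace ℝ ι) → ι → ℂ}
  {J : ℕ} {A B : ℝ≥0∞}

omit [Fintype ι] [DecidableEq ι] in
/-- `(x^{1/2})² = x` in `ℝ≥0∞`. Twin of `ENNReal.rpow_half_sq` (`FunctionSpaces/TorusFourierCalculus`),
restated in two lines rather than importing the torus Fourier calculus into this whole-space file. [folklore] -/
theorem rpow_half_sq (x : ℝ≥0∞) : (x ^ (1 / 2 : ℝ)) ^ 2 = x := by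
  rw [← ENNReal.rpow_natCast, ← ENNReal.rpow_mul]; norm_num

omit [Fintype ι] [DecidableEq ι] in
/-- `(x²)^{1/2} = x` in `ℝ≥0∞`. Twin of `Literature.Barriers.AnomalousDissipation.ennreal_sq_rpow_half`
(`Barriers/AnomalousDissipation/OnsagerSingularityLerayProofs`), restated in two lines rather than
importing a barrier file. [folklore] -/
theorem sq_rpow_half (x : ℝ≥0∞) : (x ^ 2) ^ (1 / 2 : ℝ) = x := by
  rw [← ENNReal.rpow_natCast, ← ENNReal.rpow_mul]; norm_num

namespace SliceBound

/-- The weighted convolution sum of the slices as an `ℝ≥0∞`-valued function of `(s, ξ)`. [folklore] -/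
def G (m : (EuclideanSpace ℝ ι) → ℝ) (J : ℕ) (V W : ℝ → (EuclideanSpace ℝ ι) → ι → ℂ) (s : ℝ)
    (ξ : EuclideanSpace ℝ ι) : ℝ≥0∞ :=
  ENNReal.ofReal ((1 + ‖ξ‖) ^ J * convSum (vmul m (V s)) (W s) ξ)

omit [DecidableEq ι] in
/-- Joint measurability of `G`. [folklore] -/
theorem measurable_G (h : SliceBound J A B V W) (hm : Measurable m) : Measurable (uncurry (G m J V W)) := by
  have h1 : Measurable fun p : ℝ × EuclideanSpace ℝ ι => (1 + ‖p.2‖) ^ J := by fun_prop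
  exact ENNReal.measurable_ofReal.comp (h1.mul (measurable_convSum_param hm h.measV h.measW))

omit [DecidableEq ι] in
/-- Measurability of `G` in `s` at fixed `ξ`. [folklore] -/
theorem measurable_G_time (h : SliceBound J A B V W) (hm : Measurable m) (ξ : EuclideanSpace ℝ ι) :
    Measurable fun s => G m J V W s ξ := by
  have hc : Measurable fun s : ℝ => (s, ξ) := measurable_id.prodMk measurable_const
  have h1 := (h.measurable_G hm).comp hc
  simpa only [Function.comp_def, uncurry_apply_pair] using h1

omit [DecidableEq ι] in
/-- Measurability of `G` in `ξ` at fixed `s`. [folklore] -/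
theorem measurable_G_freq (h : SliceBound J A B V W) (hm : Measurable m) (s : ℝ) :
    Measurable fun ξ => G m J V W s ξ := by
  have hc : Measurable fun ξ : EuclideanSpace ℝ ι => (s, ξ) := measurable_const.prodMk measurable_id
  have h1 := (h.measurable_G hm).comp hc
  simpa only [Function.comp_def, uncurry_apply_pair] using h1

omit [DecidableEq ι] in
/-- `G(s, ξ) = ‖wfun J (S(m•V(s), W(s))) ξ‖ₑ`. [folklore] -/
theorem G_eq_enorm_wfun (s : ℝ) (ξ : EuclideanSpace ℝ ι) :
    G m J V W s ξ = ‖wfun J (convSum (vmul m (V s)) (W s)) ξ‖ₑ := by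
  rw [G, enorm_wfun, Real.enorm_eq_ofReal (convSum_nonneg _ _ ξ), ENNReal.ofReal_mul (by positivity)]

omit [DecidableEq ι] in
/-- The pointwise bound of `G`: `G(s, ξ) ≤ card² M A B`. [folklore] -/
theorem G_le (h : SliceBound J A B V W) (hm : Measurable m) {M : ℝ} (hM : ∀ ξ, (1 + ‖ξ‖) ^ J * |m ξ| ≤ M)
    (s : ℝ) (ξ : EuclideanSpace ℝ ι) :
    G m J V W s ξ ≤ (Fintype.card ι : ℝ≥0∞) ^ 2 * (ENNReal.ofReal M * A * B) :=
  h.weight_mul_convSum_le hm hM s ξ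

omit [DecidableEq ι] in
/-- The `L²(dξ)` bound of `G(s, ·)`: `∫⁻ G(s,ξ)² dξ ≤ (card² ‖wfun J m‖_{L²} A B)²`. [folklore] -/
theorem lintegral_G_sq_le (h : SliceBound J A B V W) (hm : Measurable m) (s : ℝ) :
    ∫⁻ ξ, G m J V W s ξ ^ 2 ≤
      ((Fintype.card ι : ℝ≥0∞) ^ 2 * (eLpNorm (wfun J fun ξ => (m ξ : ℂ)) 2 volume * A * B)) ^ 2 := by
  have h1 : ∫⁻ ξ, G m J V W s ξ ^ 2 = eLpNorm (wfun J (convSum (vmul m (V s)) (W s))) 2 volume ^ 2 := by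
    rw [← lintegral_enorm_sq_eq_eLpNorm_sq]
    exact lintegral_congr fun ξ => by rw [G_eq_enorm_wfun]
  rw [h1]
  gcongr
  refine (eLpNorm_wfun_convSum_le hm (measurable_slice h.measV s) (measurable_slice h.measW s) J).trans ?_
  gcongr
  · exact h.boundV s
  · exact h.boundW s

/-- **The Duhamel term is controlled by the time-`L²` norm of `G`** (Cauchy–Schwarz in time with
the heat gain): for `t` with `τ = clamp T t`,
`(1+‖ξ‖)^J ‖D(t, ξ)‖ ≤ 4π (2c)^{-1/2} (∫₀^τ G(s, ξ)² ds)^{1/2}`. [folklore] -/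
theorem weight_mul_enorm_duhamelR_le_Z (h : SliceBound J A B V W) (hm : Measurable m)
    (hc : 0 < c) (T t : ℝ) (ξ : EuclideanSpace ℝ ι) :
    ENNReal.ofReal ((1 + ‖ξ‖) ^ J) * ‖duhamelR c m T V W t ξ‖ₑ ≤
      ENNReal.ofReal (4 * π) * ENNReal.ofReal (1 / (2 * c)) ^ (1 / 2 : ℝ) *
        (∫⁻ s in Ioc 0 (clamp T t), G m J V W s ξ ^ 2) ^ (1 / 2 : ℝ) := by
  set τ : ℝ := clamp T t with hτdef
  have hτ : 0 ≤ τ := clamp_nonneg T t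
  -- the heat part and the `G` part of the integrand
  set f : ℝ → ℝ≥0∞ := fun s => ENNReal.ofReal (‖ξ‖ * heat c ξ (τ - s)) with hf
  set g : ℝ → ℝ≥0∞ := fun s => G m J V W s ξ with hg
  have hfm : Measurable f := by
    simp only [hf, heat]
    exact ENNReal.measurable_ofReal.comp (by fun_prop)
  have hgm : Measurable g := h.measurable_G_time hm ξ
  -- pointwise bound of the weighted integrand
  have hpt : ∀ s, ENNReal.ofReal ((1 + ‖ξ‖) ^ J) * ‖heat c ξ (τ - s) • nonlin (vmul m (V s)) (W s) ξ‖ₑ ≤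
      ENNReal.ofReal (4 * π) * (f s * g s) := by
    intro s
    have hN := norm_nonlin_le_convSum' (vmul m (V s)) (W s) ξ
    have hw : 0 ≤ (1 + ‖ξ‖) ^ J := by positivity
    have hh := heat_nonneg c ξ (τ - s)
    have hS := convSum_nonneg (vmul m (V s)) (W s) ξ
    have key : (1 + ‖ξ‖) ^ J * (heat c ξ (τ - s) * ‖nonlin (vmul m (V s)) (W s) ξ‖) ≤
        4 * π * (‖ξ‖ * heat c ξ (τ - s) * ((1 + ‖ξ‖) ^ J * convSum (vmul m (V s)) (W s) ξ)) := by
      calc (1 + ‖ξ‖) ^ J * (heat c ξ (τ - s) * ‖nonlin (vmul m (V s)) (W s) ξ‖)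
          ≤ (1 + ‖ξ‖) ^ J * (heat c ξ (τ - s) * (4 * π * ‖ξ‖ * convSum (vmul m (V s)) (W s) ξ)) := by
            gcongr
        _ = 4 * π * (‖ξ‖ * heat c ξ (τ - s) * ((1 + ‖ξ‖) ^ J * convSum (vmul m (V s)) (W s) ξ)) := by ring
    calc ENNReal.ofReal ((1 + ‖ξ‖) ^ J) * ‖heat c ξ (τ - s) • nonlin (vmul m (V s)) (W s) ξ‖ₑ
        = ENNReal.ofReal ((1 + ‖ξ‖) ^ J * (heat c ξ (τ - s) * ‖nonlin (vmul m (V s)) (W s) ξ‖)) := by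
          rw [enorm_smul, Real.enorm_eq_ofReal hh, ← ofReal_norm, ← ENNReal.ofReal_mul hh,
            ← ENNReal.ofReal_mul hw]
      _ ≤ ENNReal.ofReal (4 * π * (‖ξ‖ * heat c ξ (τ - s) * ((1 + ‖ξ‖) ^ J * convSum (vmul m (V s)) (W s) ξ))) :=
          ENNReal.ofReal_le_ofReal key
      _ = ENNReal.ofReal (4 * π) * (f s * g s) := by
          have h4 : (0 : ℝ) ≤ 4 * π := by positivity
          rw [ENNReal.ofReal_mul h4, ENNReal.ofReal_mul (p := ‖ξ‖ * heat c ξ (τ - s)) (by positivity)]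
          rfl
  -- integrate
  have hD : ‖duhamelR c m T V W t ξ‖ₑ ≤ ∫⁻ s in Ioc 0 τ, ‖heat c ξ (τ - s) • nonlin (vmul m (V s)) (W s) ξ‖ₑ := by
    rw [duhamelR, ← hτdef, intervalIntegral.integral_of_le hτ]
    exact enorm_integral_le_lintegral_enorm _
  have hH := ENNReal.lintegral_mul_le_Lp_mul_Lq (volume.restrict (Ioc 0 τ)) Real.HolderConjugate.two_two
    hfm.aemeasurable hgm.aemeasurable
  have hheat : (∫⁻ s in Ioc 0 τ, f s ^ (2 : ℝ)) ^ (1 / (2 : ℝ)) ≤ ENNReal.ofReal (1 / (2 * c)) ^ (1 / 2 : ℝ) := by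
    refine ENNReal.rpow_le_rpow ?_ (by norm_num)
    simp only [hf, ENNReal.rpow_two]
    exact lintegral_heat_sq_le hc hτ ξ
  calc ENNReal.ofReal ((1 + ‖ξ‖) ^ J) * ‖duhamelR c m T V W t ξ‖ₑ
      ≤ ENNReal.ofReal ((1 + ‖ξ‖) ^ J) * ∫⁻ s in Ioc 0 τ, ‖heat c ξ (τ - s) • nonlin (vmul m (V s)) (W s) ξ‖ₑ :=
        mul_le_mul_right hD _
    _ = ∫⁻ s in Ioc 0 τ, ENNReal.ofReal ((1 + ‖ξ‖) ^ J) * ‖heat c ξ (τ - s) • nonlin (vmul m (V s)) (W s) ξ‖ₑ := by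
        rw [lintegral_const_mul' _ _ ENNReal.ofReal_ne_top]
    _ ≤ ∫⁻ s in Ioc 0 τ, ENNReal.ofReal (4 * π) * (f s * g s) := lintegral_mono fun s => hpt s
    _ = ENNReal.ofReal (4 * π) * ∫⁻ s in Ioc 0 τ, (f * g) s := by
        rw [lintegral_const_mul' _ _ ENNReal.ofReal_ne_top]; rfl
    _ ≤ ENNReal.ofReal (4 * π) * ((∫⁻ s in Ioc 0 τ, f s ^ (2 : ℝ)) ^ (1 / (2 : ℝ)) *
          (∫⁻ s in Ioc 0 τ, g s ^ (2 : ℝ)) ^ (1 / (2 : ℝ))) := mul_le_mul_right hH _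
    _ ≤ ENNReal.ofReal (4 * π) * (ENNReal.ofReal (1 / (2 * c)) ^ (1 / 2 : ℝ) *
          (∫⁻ s in Ioc 0 τ, g s ^ 2) ^ (1 / (2 : ℝ))) := by
        refine mul_le_mul_right (mul_le_mul' hheat (le_of_eq ?_)) _
        simp only [ENNReal.rpow_two]
    _ = _ := by rw [mul_assoc]

/-- The length of the clamped time interval is at most `T`: `volume (Ioc 0 (clamp T t)) ≤ ofReal T`. [folklore] -/
theorem volume_Ioc_clamp_le (hT : 0 ≤ T) (t : ℝ) :
    volume (Ioc (0 : ℝ) (clamp T t)) ≤ ENNReal.ofReal T := by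
  rw [Real.volume_Ioc, sub_zero]
  exact ENNReal.ofReal_le_ofReal (clamp_le hT t)

/-- **Pointwise bound of the Duhamel term** (sup in time of `G`): with `(1+‖ξ‖)^J |m| ≤ M`,
`(1+‖ξ‖)^J ‖D(t, ξ)‖ ≤ 4π (2c)^{-1/2} T^{1/2} card² M A B` at EVERY frequency `ξ` — the Duhamel term
has pointwise decay of the order of the weight carried by the advected field (Leray 1934, §26;
in the pseudo-measure setting Lemarié-Rieusset 2016, §8.5). [folklore] -/
theorem weight_mul_enorm_duhamelR_le (h : SliceBound J A B V W) (hm : Measurable m) (hc : 0 < c)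
    (hT : 0 ≤ T) {M : ℝ} (hM : ∀ ξ, (1 + ‖ξ‖) ^ J * |m ξ| ≤ M) (t : ℝ) (ξ : EuclideanSpace ℝ ι) :
    ENNReal.ofReal ((1 + ‖ξ‖) ^ J) * ‖duhamelR c m T V W t ξ‖ₑ ≤
      ENNReal.ofReal (4 * π) * ENNReal.ofReal (1 / (2 * c)) ^ (1 / 2 : ℝ) * ENNReal.ofReal T ^ (1 / 2 : ℝ) *
        ((Fintype.card ι : ℝ≥0∞) ^ 2 * (ENNReal.ofReal M * A * B)) := by
  set P : ℝ≥0∞ := (Fintype.card ι : ℝ≥0∞) ^ 2 * (ENNReal.ofReal M * A * B) with hP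
  refine (h.weight_mul_enorm_duhamelR_le_Z hm hc T t ξ).trans ?_
  rw [mul_assoc (ENNReal.ofReal (4 * π) * ENNReal.ofReal (1 / (2 * c)) ^ (1 / 2 : ℝ))]
  refine mul_le_mul_right ?_ _
  have h1 : ∫⁻ s in Ioc 0 (clamp T t), G m J V W s ξ ^ 2 ≤ ENNReal.ofReal T * P ^ 2 := by
    calc ∫⁻ s in Ioc 0 (clamp T t), G m J V W s ξ ^ 2 ≤ ∫⁻ _s in Ioc 0 (clamp T t), P ^ 2 :=
          lintegral_mono fun s => by gcongr; exact h.G_le hm hM s ξ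
      _ = P ^ 2 * volume (Ioc (0 : ℝ) (clamp T t)) := setLIntegral_const _ _
      _ ≤ P ^ 2 * ENNReal.ofReal T := mul_le_mul_right (volume_Ioc_clamp_le hT t) _
      _ = ENNReal.ofReal T * P ^ 2 := mul_comm _ _
  calc (∫⁻ s in Ioc 0 (clamp T t), G m J V W s ξ ^ 2) ^ (1 / 2 : ℝ)
      ≤ (ENNReal.ofReal T * P ^ 2) ^ (1 / 2 : ℝ) := ENNReal.rpow_le_rpow h1 (by norm_num)
    _ = ENNReal.ofReal T ^ (1 / 2 : ℝ) * P := by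
        rw [ENNReal.mul_rpow_of_nonneg _ _ (by norm_num), sq_rpow_half]

/-- **Weighted `L²` bound of the Duhamel term** (Tonelli in `(s, ξ)` and the slice `L²` bound of `G`):
`‖wfun J D(t)‖_{L²} ≤ 4π (2c)^{-1/2} T^{1/2} card² ‖wfun J m‖_{L²} A B`. The advecting field enters
through `A = sup ‖V‖_{L²}` only (Leray 1934, §26; Ożański–Pooley 2018, (6.81)). [folklore] -/
theorem eLpNorm_wfun_duhamelR_le (h : SliceBound J A B V W) (hm : Measurable m) (hc : 0 < c)
    (hT : 0 ≤ T) (t : ℝ) :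
    eLpNorm (wfun J (duhamelR c m T V W t)) 2 volume ≤
      ENNReal.ofReal (4 * π) * ENNReal.ofReal (1 / (2 * c)) ^ (1 / 2 : ℝ) * ENNReal.ofReal T ^ (1 / 2 : ℝ) *
        ((Fintype.card ι : ℝ≥0∞) ^ 2 * (eLpNorm (wfun J fun ξ => (m ξ : ℂ)) 2 volume * A * B)) := by
  set Q : ℝ≥0∞ := (Fintype.card ι : ℝ≥0∞) ^ 2 * (eLpNorm (wfun J fun ξ => (m ξ : ℂ)) 2 volume * A * B)
    with hQ
  set C₁ : ℝ≥0∞ := ENNReal.ofReal (4 * π) * ENNReal.ofReal (1 / (2 * c)) ^ (1 / 2 : ℝ) with hC₁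
  set τ : ℝ := clamp T t with hτ
  -- Tonelli for `G²` on `(0, T] × E`
  have hGm : AEMeasurable (uncurry fun (ξ : EuclideanSpace ℝ ι) (s : ℝ) => G m J V W s ξ ^ 2)
      ((volume : Measure (EuclideanSpace ℝ ι)).prod (volume.restrict (Ioc 0 T))) := by
    refine Measurable.aemeasurable ?_
    exact ((h.measurable_G hm).comp measurable_swap).pow_const 2
  have hTon : ∫⁻ ξ, ∫⁻ s in Ioc 0 T, G m J V W s ξ ^ 2 ≤ ENNReal.ofReal T * Q ^ 2 := by
    rw [lintegral_lintegral_swap hGm]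
    calc ∫⁻ s in Ioc 0 T, ∫⁻ ξ, G m J V W s ξ ^ 2 ≤ ∫⁻ _s in Ioc 0 T, Q ^ 2 :=
          lintegral_mono fun s => h.lintegral_G_sq_le hm s
      _ = Q ^ 2 * volume (Ioc (0 : ℝ) T) := setLIntegral_const _ _
      _ = ENNReal.ofReal T * Q ^ 2 := by rw [Real.volume_Ioc, sub_zero, mul_comm]
  -- compare squares
  have hid : ∀ x y z : ℝ≥0∞, (x * y ^ (1 / 2 : ℝ) * z) ^ 2 = x ^ 2 * (y * z ^ 2) := fun x y z => by
    rw [mul_pow, mul_pow, rpow_half_sq, mul_assoc]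
  have hsq : eLpNorm (wfun J (duhamelR c m T V W t)) 2 volume ^ 2 ≤
      (C₁ * ENNReal.ofReal T ^ (1 / 2 : ℝ) * Q) ^ 2 := by
    rw [← lintegral_enorm_sq_eq_eLpNorm_sq]
    calc ∫⁻ ξ, ‖wfun J (duhamelR c m T V W t) ξ‖ₑ ^ 2
        ≤ ∫⁻ ξ, (C₁ * (∫⁻ s in Ioc 0 τ, G m J V W s ξ ^ 2) ^ (1 / 2 : ℝ)) ^ 2 := by
          refine lintegral_mono fun ξ => ?_
          rw [enorm_wfun]
          exact pow_le_pow_left₀ zero_le (h.weight_mul_enorm_duhamelR_le_Z hm hc T t ξ) 2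
      _ = C₁ ^ 2 * ∫⁻ ξ, ∫⁻ s in Ioc 0 τ, G m J V W s ξ ^ 2 := by
          simp_rw [mul_pow, rpow_half_sq]
          rw [lintegral_const_mul' _ _ (by
            simp only [hC₁]
            exact ENNReal.pow_ne_top (ENNReal.mul_ne_top ENNReal.ofReal_ne_top
              (ENNReal.rpow_ne_top_of_nonneg (by norm_num) ENNReal.ofReal_ne_top)))]
      _ ≤ C₁ ^ 2 * ∫⁻ ξ, ∫⁻ s in Ioc 0 T, G m J V W s ξ ^ 2 := by
          refine mul_le_mul_right (lintegral_mono fun ξ => ?_) _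
          exact lintegral_mono_set (Ioc_subset_Ioc le_rfl (clamp_le hT t))
      _ ≤ C₁ ^ 2 * (ENNReal.ofReal T * Q ^ 2) := mul_le_mul_right hTon _
      _ = (C₁ * ENNReal.ofReal T ^ (1 / 2 : ℝ) * Q) ^ 2 := (hid C₁ (ENNReal.ofReal T) Q).symm
  exact (ENNReal.pow_le_pow_left_iff two_ne_zero).1 hsq

end SliceBound

end Estimates

/-! ### Measurability, time continuity and bilinearity of the Duhamel term -/

section Structure

variable {c T : ℝ} {m : (EuclideanSpace ℝ ι) → ℝ} {V W : ℝ → (EuclideanSpace ℝ ι) → ι → ℂ}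
  {J : ℕ} {A B : ℝ≥0∞}

namespace SliceBound

/-- Joint measurability of the Duhamel integrand in `(s, ξ)` at fixed `τ`. [folklore] -/
theorem measurable_integrand₂ (h : SliceBound J A B V W) (hm : Measurable m) (c τ : ℝ) :
    Measurable fun p : ℝ × EuclideanSpace ℝ ι => heat c p.2 (τ - p.1) • nonlin (vmul m (V p.1)) (W p.1) p.2 := by
  have h1 : Measurable fun p : ℝ × EuclideanSpace ℝ ι => heat c p.2 (τ - p.1) := by unfold heat; fun_prop
  exact h1.smul (measurable_nonlin_param hm h.measV h.measW)

/-- **Measurability of the slices of the Duhamel term** `ξ ↦ D(t, ξ)` (Fubini measurability of a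
parametric integral over `s ∈ (0, τ]`). [folklore] -/
theorem measurable_duhamelR_slice (h : SliceBound J A B V W) (hm : Measurable m) (c T t : ℝ) :
    Measurable (duhamelR c m T V W t) := by
  set τ : ℝ := clamp T t with hτdef
  have hτ : 0 ≤ τ := clamp_nonneg T t
  have hI : StronglyMeasurable (uncurry fun (ξ : EuclideanSpace ℝ ι) (s : ℝ) =>
      heat c ξ (τ - s) • nonlin (vmul m (V s)) (W s) ξ) :=
    ((h.measurable_integrand₂ hm c τ).comp measurable_swap).stronglyMeasurable
  have hF := hI.integral_prod_right' (ν := volume.restrict (Ioc 0 τ))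
  have heq : (fun ξ : EuclideanSpace ℝ ι => ∫ s, uncurry (fun (ξ : EuclideanSpace ℝ ι) (s : ℝ) =>
      heat c ξ (τ - s) • nonlin (vmul m (V s)) (W s) ξ) (ξ, s) ∂(volume.restrict (Ioc 0 τ))) =
      duhamelR c m T V W t := by
    funext ξ
    rw [duhamelR, ← hτdef, intervalIntegral.integral_of_le hτ]
    rfl
  rw [heq] at hF
  exact hF.measurable

/-- A crude bound for the Duhamel integrand on an arbitrary bounded set of times: for `|s| ≤ R`,
`‖e^{-c‖ξ‖²(τ-s)} N(s, ξ)‖ ≤ e^{c‖ξ‖²(|τ|+R)} 4π‖ξ‖ (card² A B).toReal` (`c ≥ 0`). [folklore] -/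
theorem norm_integrand_le_exp (h : SliceBound J A B V W) (hm : Measurable m) (hm1 : ∀ ξ, |m ξ| ≤ 1)
    (hc : 0 ≤ c) {τ s R : ℝ} (hs : |s| ≤ R) (ξ : EuclideanSpace ℝ ι) :
    ‖heat c ξ (τ - s) • nonlin (vmul m (V s)) (W s) ξ‖ ≤
      Real.exp (c * ‖ξ‖ ^ 2 * (|τ| + R)) * (4 * π * ‖ξ‖ * ((Fintype.card ι : ℝ≥0∞) ^ 2 * (A * B)).toReal) := by
  rw [norm_heat_smul]
  refine mul_le_mul ?_ ?_ (norm_nonneg _) (Real.exp_pos _).le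
  · rw [heat, Real.exp_le_exp]
    have h1 : -(τ - s) ≤ |τ| + R := by
      have := neg_abs_le τ; have := le_abs_self s; linarith
    calc -(c * ‖ξ‖ ^ 2) * (τ - s) = c * ‖ξ‖ ^ 2 * (-(τ - s)) := by ring
      _ ≤ c * ‖ξ‖ ^ 2 * (|τ| + R) := mul_le_mul_of_nonneg_left h1 (by positivity)
  · exact (norm_nonlin_le_convSum' _ _ ξ).trans
      (mul_le_mul_of_nonneg_left (h.convSum_le_toReal hm hm1 s ξ) (by positivity))

/-- Interval integrability of the Duhamel integrand on every interval. [folklore] -/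
theorem intervalIntegrable_integrand' (h : SliceBound J A B V W) (hm : Measurable m)
    (hm1 : ∀ ξ, |m ξ| ≤ 1) (hc : 0 ≤ c) (τ : ℝ) (ξ : EuclideanSpace ℝ ι) (a b : ℝ) :
    IntervalIntegrable (fun s => heat c ξ (τ - s) • nonlin (vmul m (V s)) (W s) ξ) volume a b := by
  refine (Measure.integrableOn_of_bounded (s := Set.uIcc a b)
    (M := Real.exp (c * ‖ξ‖ ^ 2 * (|τ| + (|a| + |b|))) * (4 * π * ‖ξ‖ * ((Fintype.card ι : ℝ≥0∞) ^ 2 * (A * B)).toReal))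
    ?_ (h.measurable_integrand hm c τ ξ).aestronglyMeasurable ?_).intervalIntegrable
  · rw [Real.volume_interval]; exact ENNReal.ofReal_ne_top
  · refine (ae_restrict_iff' measurableSet_uIcc).2 (Eventually.of_forall fun s hs' => ?_)
    refine h.norm_integrand_le_exp hm hm1 hc ?_ ξ
    rw [Set.mem_uIcc] at hs'
    rcases hs' with ⟨h1, h2⟩ | ⟨h1, h2⟩
    · rw [abs_le]; constructor <;> linarith [neg_abs_le a, le_abs_self b, neg_abs_le b, le_abs_self a]
    · rw [abs_le]; constructor <;> linarith [neg_abs_le a, le_abs_self b, neg_abs_le b, le_abs_self a]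

/-- **Time continuity of the Duhamel term at a fixed frequency**: `t ↦ D(t, ξ)` is continuous
(`e^{-c‖ξ‖²(τ-s)} = e^{-c‖ξ‖²τ} e^{c‖ξ‖²s}` factors the `τ`-dependence out of the integrand; the
primitive of a locally integrable function is continuous; `clamp` is continuous). [folklore] -/
theorem continuous_duhamelR_time (h : SliceBound J A B V W) (hm : Measurable m) (hm1 : ∀ ξ, |m ξ| ≤ 1)
    (hc : 0 ≤ c) (T : ℝ) (ξ : EuclideanSpace ℝ ι) : Continuous fun t => duhamelR c m T V W t ξ := by
  -- the integrand with the `τ`-dependence factored out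
  set g : ℝ → ι → ℂ := fun s => heat c ξ (0 - s) • nonlin (vmul m (V s)) (W s) ξ with hg
  have hgi : ∀ a b, IntervalIntegrable g volume a b := fun a b => h.intervalIntegrable_integrand' hm hm1 hc 0 ξ a b
  have hprim : Continuous fun τ => ∫ s in (0 : ℝ)..τ, g s := intervalIntegral.continuous_primitive hgi 0
  have hfac : ∀ τ s, heat c ξ (τ - s) • nonlin (vmul m (V s)) (W s) ξ = heat c ξ τ • g s := by
    intro τ s
    rw [hg, smul_smul, ← heat_add]
    congr 1; ring_nf
  have heq : (fun t => duhamelR c m T V W t ξ) = fun t => heat c ξ (clamp T t) • ∫ s in (0 : ℝ)..clamp T t, g s := by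
    funext t
    rw [duhamelR, ← intervalIntegral.integral_smul]
    exact intervalIntegral.integral_congr fun s _ => hfac _ s
  rw [heq]
  exact (continuous_heat_comp c continuous_const (continuous_clamp T)).smul (hprim.comp (continuous_clamp T))

/-- **Joint measurability of the Duhamel term** in `(t, ξ)` (Carathéodory: continuous in `t`,
measurable in `ξ`). [folklore] -/
theorem measurable_uncurry_duhamelR (h : SliceBound J A B V W) (hm : Measurable m) (hm1 : ∀ ξ, |m ξ| ≤ 1)
    (hc : 0 ≤ c) (T : ℝ) : Measurable (uncurry (duhamelR c m T V W)) :=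
  (stronglyMeasurable_uncurry_of_continuous_of_stronglyMeasurable
    (fun ξ => h.continuous_duhamelR_time hm hm1 hc T ξ)
    (fun t => (h.measurable_duhamelR_slice hm c T t).stronglyMeasurable)).measurable

omit [DecidableEq ι] in
/-- Slices with a finite uniform `L²` bound are in `L²`. [folklore] -/
theorem memLp_V (h : SliceBound J A B V W) (s : ℝ) : MemLp (V s) 2 volume :=
  ⟨(measurable_slice h.measV s).aestronglyMeasurable, (h.boundV s).trans_lt h.A_ne_top.lt_top⟩

omit [DecidableEq ι] in
/-- Slices with a finite uniform weighted `L²` bound are in `L²`. [folklore] -/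
theorem memLp_W (h : SliceBound J A B V W) (s : ℝ) : MemLp (W s) 2 volume :=
  ⟨(measurable_slice h.measW s).aestronglyMeasurable, (h.boundW₀ s).trans_lt h.B_ne_top.lt_top⟩

end SliceBound

/-- **Bilinearity of the Duhamel term in the advecting slot**:
`D(V₁ - V₂, W) = D(V₁, W) - D(V₂, W)` pointwise (interval-integral linearity and the pointwise
bilinearity of the regularised nonlinearity under square-integrability). [folklore] -/
theorem duhamelR_sub_left {V₁ V₂ : ℝ → (EuclideanSpace ℝ ι) → ι → ℂ} {A₁ A₂ : ℝ≥0∞}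
    (h₁ : SliceBound J A₁ B V₁ W) (h₂ : SliceBound J A₂ B V₂ W) (hm : Measurable m)
    (hm1 : ∀ ξ, |m ξ| ≤ 1) (hc : 0 ≤ c) (T t : ℝ) (ξ : EuclideanSpace ℝ ι) :
    duhamelR c m T (V₁ - V₂) W t ξ = duhamelR c m T V₁ W t ξ - duhamelR c m T V₂ W t ξ := by
  have hτ : 0 ≤ clamp T t := clamp_nonneg T t
  rw [duhamelR, duhamelR, duhamelR, ← intervalIntegral.integral_sub
    (h₁.intervalIntegrable_integrand hm hm1 hc hτ ξ) (h₂.intervalIntegrable_integrand hm hm1 hc hτ ξ)]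
  refine intervalIntegral.integral_congr fun s _ => ?_
  simp only [Pi.sub_apply, ← smul_sub]
  rw [nonlin_vmul_sub_left hm hm1 (h₁.memLp_V s) (h₂.memLp_V s) (h₁.memLp_W s)]

/-- **Bilinearity of the Duhamel term in the advected slot**:
`D(V, W₁ - W₂) = D(V, W₁) - D(V, W₂)` pointwise. [folklore] -/
theorem duhamelR_sub_right {W₁ W₂ : ℝ → (EuclideanSpace ℝ ι) → ι → ℂ} {B₁ B₂ : ℝ≥0∞}
    (h₁ : SliceBound J A B₁ V W₁) (h₂ : SliceBound J A B₂ V W₂) (hm : Measurable m)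
    (hm1 : ∀ ξ, |m ξ| ≤ 1) (hc : 0 ≤ c) (T t : ℝ) (ξ : EuclideanSpace ℝ ι) :
    duhamelR c m T V (W₁ - W₂) t ξ = duhamelR c m T V W₁ t ξ - duhamelR c m T V W₂ t ξ := by
  have hτ : 0 ≤ clamp T t := clamp_nonneg T t
  rw [duhamelR, duhamelR, duhamelR, ← intervalIntegral.integral_sub
    (h₁.intervalIntegrable_integrand hm hm1 hc hτ ξ) (h₂.intervalIntegrable_integrand hm hm1 hc hτ ξ)]
  refine intervalIntegral.integral_congr fun s _ => ?_
  simp only [Pi.sub_apply, ← smul_sub]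
  rw [nonlin_vmul_sub_right hm hm1 (h₁.memLp_V s) (h₁.memLp_W s) (h₂.memLp_W s)]

end Structure

end Literature.Analysis.FluidPDE.FourierNS

end
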